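import Mathlib
import Literature.MathematicalPhysics.StatisticalMechanics.LayerSumDecay
import Summits.AtomisticToContinuum.Crystallization.Theorems.NashClassCertificatesNashNearFieldStubLayerLandscapeTri

/-!
# Crux `NashNearField` (16827), stubs `stub_triLandscapeNear` / `stub_triLandscapeFar`: certified truncation I —
# the planar majorant with a level cut-off (deformed `LayerSumDecay`)

Every layer sum in the word-free functional `W(t; a, h)` — deformed, `∑_{(i,j)} V_LJ(√q_t(i,j))` with
`q_t = (t₀₀X + t₀₁Y + t₀₂Z)² + (t₁₁Y + t₁₂Z)² + (t₂₂Z)²`, or reference, `layerInteraction V_LJ a h δ s` with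
`‖layerVec a h δ s i j‖² = a² Q_δ(i,j) + s²h²` — is a sum of `V_LJ(√q)` over `ℤ²` where the squared distance dominates an
affine image of the planar form, `a₁² Q_δ(i,j) + c₂ ≤ q(i,j)` (`Q_δ(i,j) = (i + j/2 + δ/2)² + ¾(j + δ/3)²`; for the deformed
sums `a₁² = 16/25`, `c₂ = (32/75)s²` by the tube, for the reference sums `a₁ = 47/50`, `c₂ = s²·(39·47/2500)²`).  This file
proves the ONE estimate both need, with a level cut-off `m₀` so that it also bounds in-plane truncation tails:

* `tri_sum_le_of_cumulative_count_affine` — layer-cake with affine cumulative counts `≤ B(m+1) + B₀`: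
  `∑_{x∈F} f(t x) ≤ B ∑_{n≤T} f n + B₀ f 0` (the `B₀ f 0` term is what makes annular counts usable);
* `tri_sum_abs_lj_sqrt_le_of_planar` — **planar majorant with cut-off**: if `a₁² Q_δ + c₂ ≤ q` and `m₀ ≤ Q_δ` on a finite
  `F ⊆ ℤ²` (`β := a₁² m₀ + c₂ > 0`), then
  `∑_{F} |V_LJ(√q)| ≤ (β⁻³/12 + 1/6)·(10((β³)⁻¹ + 1/(a₁² β²)) + 10 m₀ (β³)⁻¹)` — `O(m₀⁻²) = O(R⁻⁴)` in the in-plane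
  cut-off radius `R = √m₀`, `O(s⁻⁴)` in the layer distance through `c₂ ∝ s²` (whole layers: `m₀ = 0`).
  Ingredients: `|V(r)| ≤ (ρ⁻⁶/12 + 1/6) r⁻⁶` for `r ≥ ρ` (`abs_lennardJones_le_of_le`), the cumulative planar counts
  `#{Q_δ < m} ≤ 10 m` (`card_filter_planarForm_lt_le`), the telescoping bound `∑_n (α n + β)⁻³ ≤ β⁻³ + 1/(α β²)`
  (`sum_range_inv_cube_affine_le`).
-/

noncomputable section

open scoped BigOperators
open Literature.MathematicalPhysics.StatisticalMechanics Literature.Geometry.DiscreteGeometry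

namespace Summit.AtomisticToContinuum.Crystallization.Theorems.NashClassCertificatesNashNearField

/-- **Layer-cake bound with affine cumulative counts.**  If every `x ∈ F` carries a level `t x ≤ T`, the cumulative
level counts are `#{x ∈ F : t x ≤ m} ≤ B (m + 1) + B₀` (`B₀ ≥ 0`), and `f` is non-increasing with `f T ≥ 0`, then
`∑_{x ∈ F} f (t x) ≤ B ∑_{n ≤ T} f n + B₀ f 0`. [folklore] -/
theorem tri_sum_le_of_cumulative_count_affine {ι : Type*} (F : Finset ι) (t : ι → ℕ) (T : ℕ)
    (htT : ∀ x ∈ F, t x ≤ T) {B B₀ : ℝ}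
    (hcount : ∀ m : ℕ, m ≤ T → ((F.filter fun x => t x ≤ m).card : ℝ) ≤ B * (m + 1) + B₀)
    (f : ℕ → ℝ) (hf : ∀ n, f (n + 1) ≤ f n) (hfT : 0 ≤ f T) :
    ∑ x ∈ F, f (t x) ≤ B * ∑ n ∈ Finset.range (T + 1), f n + B₀ * f 0 := by
  classical
  -- adapted from `sum_le_of_cumulative_count` (LayerSumDecay)
  have htel : ∀ x ∈ F, f (t x) = f T + ∑ m ∈ Finset.range T,
      (if t x ≤ m then f m - f (m + 1) else 0) := by
    intro x hx
    have htx := htT x hx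
    have h1 : ∑ m ∈ Finset.range T, (if t x ≤ m then f m - f (m + 1) else 0) =
        ∑ m ∈ Finset.Ico (t x) T, (f m - f (m + 1)) := by
      rw [Finset.range_eq_Ico]
      rw [← Finset.sum_Ico_consecutive (fun m => if t x ≤ m then f m - f (m + 1) else 0)
        (Nat.zero_le (t x)) htx]
      have hz : ∑ m ∈ Finset.Ico 0 (t x), (if t x ≤ m then f m - f (m + 1) else 0) = 0 :=
        Finset.sum_eq_zero fun m hm => by
          rw [Finset.mem_Ico] at hm; rw [if_neg (by omega)]
      rw [hz, zero_add]
      exact Finset.sum_congr rfl fun m hm => by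
        rw [Finset.mem_Ico] at hm; rw [if_pos hm.1]
    have h2 : ∑ m ∈ Finset.Ico (t x) T, (f m - f (m + 1)) = f (t x) - f T := by
      rw [Finset.sum_Ico_eq_sum_range]
      have := Finset.sum_range_sub' (fun k => f (t x + k)) (T - t x)
      simp only [add_zero] at this
      rw [Nat.add_sub_cancel' htx] at this
      rw [← this]
      exact Finset.sum_congr rfl fun k _ => by rw [add_assoc]
    rw [h1, h2]; ring
  rw [Finset.sum_congr rfl htel, Finset.sum_add_distrib, Finset.sum_const, nsmul_eq_mul,
    Finset.sum_comm]
  have hinner : ∀ m ∈ Finset.range T,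
      ∑ x ∈ F, (if t x ≤ m then f m - f (m + 1) else 0) =
        ((F.filter fun x => t x ≤ m).card : ℝ) * (f m - f (m + 1)) := by
    intro m _
    rw [← Finset.sum_filter, Finset.sum_const, nsmul_eq_mul]
  rw [Finset.sum_congr rfl hinner]
  have hF : (F.card : ℝ) ≤ B * (T + 1) + B₀ := by
    have := hcount T le_rfl
    rwa [Finset.filter_true_of_mem (fun x hx => htT x hx)] at this
  have htel0 : ∑ m ∈ Finset.range T, (f m - f (m + 1)) = f 0 - f T := by
    have := Finset.sum_range_sub' f T
    linarith [this, show ∑ m ∈ Finset.range T, (f m - f (m + 1)) = -∑ m ∈ Finset.range T, (f (m + 1) - f m) by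
      rw [← Finset.sum_neg_distrib]; exact Finset.sum_congr rfl fun m _ => by ring]
  calc (F.card : ℝ) * f T + ∑ m ∈ Finset.range T, ((F.filter fun x => t x ≤ m).card : ℝ) * (f m - f (m + 1))
      ≤ (B * (T + 1) + B₀) * f T + ∑ m ∈ Finset.range T, (B * (m + 1) + B₀) * (f m - f (m + 1)) := by
        gcongr with m hm
        · exact sub_nonneg.2 (hf m)
        · exact hcount m (Finset.mem_range.1 hm).le
    _ = B * ((T + 1 : ℝ) * f T + ∑ m ∈ Finset.range T, ((m : ℝ) + 1) * (f m - f (m + 1))) +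
          B₀ * (f T + ∑ m ∈ Finset.range T, (f m - f (m + 1))) := by
        have e : ∑ m ∈ Finset.range T, (B * (m + 1) + B₀) * (f m - f (m + 1)) =
            B * ∑ m ∈ Finset.range T, ((m : ℝ) + 1) * (f m - f (m + 1)) +
              B₀ * ∑ m ∈ Finset.range T, (f m - f (m + 1)) := by
          rw [Finset.mul_sum, Finset.mul_sum, ← Finset.sum_add_distrib]
          exact Finset.sum_congr rfl fun m _ => by ring
        rw [e]; ring
    _ = B * ∑ n ∈ Finset.range (T + 1), f n + B₀ * f 0 := by
        rw [layerCake_identity, htel0]; ring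

/-- `|V_LJ(√q)| ≤ (β⁻³/12 + 1/6)·(q³)⁻¹` for `q ≥ β > 0` (the Lennard-Jones majorant through the squared distance).
[folklore] -/
theorem tri_abs_lj_sqrt_le {β q : ℝ} (hβ : 0 < β) (hq : β ≤ q) :
    |lennardJones (Real.sqrt q)| ≤ (β⁻¹ ^ 3 / 12 + 1 / 6) * (q ^ 3)⁻¹ := by
  have hq0 : 0 < q := hβ.trans_le hq
  have h1 : 0 < Real.sqrt β := Real.sqrt_pos.2 hβ
  have h2 : Real.sqrt β ≤ Real.sqrt q := Real.sqrt_le_sqrt hq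
  have h := abs_lennardJones_le_of_le h1 h2
  have e1 : (Real.sqrt β)⁻¹ ^ 6 = β⁻¹ ^ 3 := by
    rw [inv_pow, inv_pow, show (6 : ℕ) = 2 * 3 by rfl, pow_mul, Real.sq_sqrt hβ.le]
  have e2 : (Real.sqrt q)⁻¹ ^ 6 = (q ^ 3)⁻¹ := by
    rw [inv_pow, show (6 : ℕ) = 2 * 3 by rfl, pow_mul, Real.sq_sqrt hq0.le]
  rwa [e1, e2] at h

/-- **The planar majorant with a level cut-off (deformed `LayerSumDecay`).**  Let `q : ℤ² → ℝ` dominate an affine image of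
the planar form on a finite set `F`: `a₁² Q_δ(i,j) + c₂ ≤ q(i,j)` with `Q_δ(i,j) = (i + j/2 + δ/2)² + ¾(j + δ/3)²`, `a₁² > 0`,
`c₂ ≥ 0`, and let all points of `F` have level `≥ m₀` (`m₀ ≤ Q_δ`), `β := a₁² m₀ + c₂ > 0`.  Then
`∑_{F} |V_LJ(√q)| ≤ (β⁻³/12 + 1/6)·(10((β³)⁻¹ + 1/(a₁² β²)) + 10 m₀ (β³)⁻¹)`.  With `m₀ = 0` this is the whole-layer bound
(`O(s⁻⁴)` through `c₂ ∝ s²`); with `m₀ = R²` it bounds the in-plane truncation tail beyond radius `R` (`O(R⁻⁴)`), for deformed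
(tube: `a₁² = 16/25`, `c₂ = 32 s²/75`) and reference layer sums alike. [folklore] -/
theorem tri_sum_abs_lj_sqrt_le_of_planar (δ : ℤ) {a₁sq c₂ : ℝ} (m₀ : ℕ) (ha : 0 < a₁sq)
    (hβ : 0 < a₁sq * m₀ + c₂) (q : ℤ × ℤ → ℝ) (F : Finset (ℤ × ℤ))
    (hq : ∀ ij ∈ F, a₁sq * (((ij.1 : ℝ) + ij.2 / 2 + δ / 2) ^ 2 + 3 / 4 * ((ij.2 : ℝ) + δ / 3) ^ 2) + c₂ ≤ q ij)
    (hm : ∀ ij ∈ F, (m₀ : ℝ) ≤ ((ij.1 : ℝ) + ij.2 / 2 + δ / 2) ^ 2 + 3 / 4 * ((ij.2 : ℝ) + δ / 3) ^ 2) :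
    ∑ ij ∈ F, |lennardJones (Real.sqrt (q ij))| ≤
      ((a₁sq * m₀ + c₂)⁻¹ ^ 3 / 12 + 1 / 6) *
        (10 * (((a₁sq * m₀ + c₂) ^ 3)⁻¹ + 1 / (a₁sq * (a₁sq * m₀ + c₂) ^ 2)) +
          10 * m₀ * ((a₁sq * m₀ + c₂) ^ 3)⁻¹) := by
  classical
  set β : ℝ := a₁sq * m₀ + c₂ with hβdef
  set M : ℝ := β⁻¹ ^ 3 / 12 + 1 / 6 with hM
  have hM0 : 0 ≤ M := by positivity
  set Q : ℤ × ℤ → ℝ := fun ij =>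
    ((ij.1 : ℝ) + ij.2 / 2 + δ / 2) ^ 2 + 3 / 4 * ((ij.2 : ℝ) + δ / 3) ^ 2 with hQ
  have hQ0 : ∀ ij, 0 ≤ Q ij := fun ij => by positivity
  set f : ℕ → ℝ := fun n => M * ((a₁sq * n + β) ^ 3)⁻¹ with hf
  have hf_anti : ∀ n, f (n + 1) ≤ f n := by
    intro n
    simp only [hf]
    gcongr
    · linarith
  have hf0 : ∀ n, 0 ≤ f n := fun n => by positivity
  set t : ℤ × ℤ → ℕ := fun ij => ⌊Q ij⌋₊ - m₀ with ht
  -- per-point bound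
  have hpt : ∀ ij ∈ F, |lennardJones (Real.sqrt (q ij))| ≤ f (t ij) := by
    intro ij hij
    have hqij : a₁sq * Q ij + c₂ ≤ q ij := hq ij hij
    have hmij : (m₀ : ℝ) ≤ Q ij := hm ij hij
    have hfl : m₀ ≤ ⌊Q ij⌋₊ := Nat.le_floor hmij
    have htc : (t ij : ℝ) = (⌊Q ij⌋₊ : ℝ) - m₀ := by
      simp only [ht]; rw [Nat.cast_sub hfl]
    have hfloor : (⌊Q ij⌋₊ : ℝ) ≤ Q ij := Nat.floor_le (hQ0 ij)
    have hD : a₁sq * (t ij : ℝ) + β ≤ q ij := by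
      rw [htc, hβdef]
      nlinarith [mul_le_mul_of_nonneg_left hfloor ha.le]
    have hβq : β ≤ q ij := by
      rw [hβdef]; nlinarith [mul_le_mul_of_nonneg_left hmij ha.le]
    have hV := tri_abs_lj_sqrt_le hβ hβq
    refine hV.trans ?_
    simp only [hf, ← hM]
    have hDpos : 0 < a₁sq * (t ij : ℝ) + β := by positivity
    gcongr
  -- layer-cake summation with the affine counts `10 (m+1) + 10 m₀`
  set T : ℕ := F.sup t with hT
  have htT : ∀ ij ∈ F, t ij ≤ T := fun ij hij => Finset.le_sup hij
  have hcount : ∀ m : ℕ, m ≤ T → ((F.filter fun ij => t ij ≤ m).card : ℝ) ≤ 10 * (m + 1) + 10 * m₀ := by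
    intro m _
    have hsub : (F.filter fun ij => t ij ≤ m) ⊆ F.filter fun ij : ℤ × ℤ =>
        ((ij.1 : ℝ) + ij.2 / 2 + δ / 2) ^ 2 + 3 / 4 * ((ij.2 : ℝ) + δ / 3) ^ 2 < (m : ℝ) + m₀ + 1 := by
      intro ij hij
      rw [Finset.mem_filter] at hij ⊢
      refine ⟨hij.1, ?_⟩
      have h1 : Q ij < (⌊Q ij⌋₊ : ℝ) + 1 := Nat.lt_floor_add_one (Q ij)
      have h2 : ⌊Q ij⌋₊ ≤ m + m₀ := by have := hij.2; simp only [ht] at this; omega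
      have h3 : (⌊Q ij⌋₊ : ℝ) ≤ (m : ℝ) + m₀ := by exact_mod_cast h2
      show Q ij < m + m₀ + 1
      linarith
    calc ((F.filter fun ij => t ij ≤ m).card : ℝ) ≤ ((F.filter fun ij : ℤ × ℤ =>
          ((ij.1 : ℝ) + ij.2 / 2 + δ / 2) ^ 2 + 3 / 4 * ((ij.2 : ℝ) + δ / 3) ^ 2 < (m : ℝ) + m₀ + 1).card
            : ℝ) := by exact_mod_cast Finset.card_le_card hsub
      _ ≤ 10 * ((m : ℝ) + m₀ + 1) := by
          have := card_filter_planarForm_lt_le δ F (m := (m : ℝ) + m₀ + 1)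
            (by linarith [m.cast_nonneg (α := ℝ), m₀.cast_nonneg (α := ℝ)])
          exact_mod_cast this
      _ = 10 * (m + 1) + 10 * m₀ := by ring
  have hcake := tri_sum_le_of_cumulative_count_affine F t T htT hcount f hf_anti (hf0 T)
  have hlevel : ∑ n ∈ Finset.range (T + 1), f n ≤ M * ((β ^ 3)⁻¹ + 1 / (a₁sq * β ^ 2)) := by
    rw [← Finset.mul_sum]
    exact mul_le_mul_of_nonneg_left (sum_range_inv_cube_affine_le ha hβ T) hM0
  have hf0' : f 0 = M * (β ^ 3)⁻¹ := by simp only [hf, Nat.cast_zero, mul_zero, zero_add]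
  have hm₀ : (0 : ℝ) ≤ 10 * m₀ := by positivity
  calc ∑ ij ∈ F, |lennardJones (Real.sqrt (q ij))|
      ≤ ∑ ij ∈ F, f (t ij) := Finset.sum_le_sum fun ij hij => hpt ij hij
    _ ≤ 10 * ∑ n ∈ Finset.range (T + 1), f n + 10 * m₀ * f 0 := hcake
    _ ≤ 10 * (M * ((β ^ 3)⁻¹ + 1 / (a₁sq * β ^ 2))) + 10 * m₀ * (M * (β ^ 3)⁻¹) := by
        rw [hf0']; gcongr
    _ = M * (10 * ((β ^ 3)⁻¹ + 1 / (a₁sq * β ^ 2)) + 10 * m₀ * (β ^ 3)⁻¹) := by ring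



/-- **Stub piece `stub_triPlanarMajorant` (proved; registered form of `tri_sum_abs_lj_sqrt_le_of_planar`).** [folklore] -/
theorem stub_triPlanarMajorant :
    ∀ (δ : ℤ) (a₁sq c₂ : ℝ) (m₀ : ℕ) (q : ℤ × ℤ → ℝ) (F : Finset (ℤ × ℤ)), 0 < a₁sq → 0 < a₁sq * m₀ + c₂ →
      (∀ ij ∈ F, a₁sq * (((ij.1 : ℝ) + ij.2 / 2 + δ / 2) ^ 2 + 3 / 4 * ((ij.2 : ℝ) + δ / 3) ^ 2) + c₂ ≤ q ij) →
      (∀ ij ∈ F, (m₀ : ℝ) ≤ (((ij.1 : ℝ) + ij.2 / 2 + δ / 2) ^ 2 + 3 / 4 * ((ij.2 : ℝ) + δ / 3) ^ 2)) →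
      ∑ ij ∈ F, |lennardJones (Real.sqrt (q ij))| ≤
        ((a₁sq * m₀ + c₂)⁻¹ ^ 3 / 12 + 1 / 6) *
          (10 * (((a₁sq * m₀ + c₂) ^ 3)⁻¹ + 1 / (a₁sq * (a₁sq * m₀ + c₂) ^ 2)) + 10 * m₀ * ((a₁sq * m₀ + c₂) ^ 3)⁻¹) :=
  fun δ _ _ m₀ q F ha hβ hq hm => tri_sum_abs_lj_sqrt_le_of_planar δ m₀ ha hβ q F hq hm

/-! ## The two instances: deformed layer sums (tube) and reference layer sums (box) -/

/-- The unit-template layer vector has squared norm `Q_δ(i,j) + (2/3)s²` in coordinates. [folklore] -/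
theorem tri_coord_sq_eq (δ s i j : ℤ) :
    ((i : ℝ) + (j : ℝ) / 2 + (δ : ℝ) / 2) ^ 2 + (Real.sqrt 3 / 2 * ((j : ℝ) + (δ : ℝ) / 3)) ^ 2 +
        ((s : ℝ) * (Real.sqrt 6 / 3)) ^ 2 =
      (((i : ℝ) + j / 2 + δ / 2) ^ 2 + 3 / 4 * ((j : ℝ) + δ / 3) ^ 2) + 2 / 3 * (s : ℝ) ^ 2 := by
  have h3 : Real.sqrt 3 ^ 2 = 3 := Real.sq_sqrt (by norm_num)
  have h6 : Real.sqrt 6 ^ 2 = 6 := Real.sq_sqrt (by norm_num)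
  nlinarith [h3, h6]

/-- **Deformed layer sums, in-plane tails and whole layers (tube ⇒ `16/25·Q_δ + 32 s²/75 ≤ q_t`).**  For `t` in the
polynomial tube and a finite `F ⊆ ℤ²` of points of level `≥ m₀` (with `16 m₀/25 + 32 s²/75 > 0`),
`∑_F |V_LJ(√q_t)| ≤` the planar majorant at `(a₁², c₂) = (16/25, 32 s²/75)`. [folklore] -/
theorem tri_sum_abs_deformed_le (t₀₀ t₀₁ t₀₂ t₁₁ t₁₂ t₂₂ : ℝ)
    (htube : ∀ x y z : ℝ, (4 / 5 : ℝ) ^ 2 * (x ^ 2 + y ^ 2 + z ^ 2) ≤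
      (t₀₀ * x + t₀₁ * y + t₀₂ * z) ^ 2 + (t₁₁ * y + t₁₂ * z) ^ 2 + (t₂₂ * z) ^ 2 ∧
      (t₀₀ * x + t₀₁ * y + t₀₂ * z) ^ 2 + (t₁₁ * y + t₁₂ * z) ^ 2 + (t₂₂ * z) ^ 2 ≤
        (6 / 5 : ℝ) ^ 2 * (x ^ 2 + y ^ 2 + z ^ 2))
    (δ s : ℤ) (m₀ : ℕ) (hβ : 0 < 16 / 25 * (m₀ : ℝ) + 32 / 75 * (s : ℝ) ^ 2) (F : Finset (ℤ × ℤ))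
    (hm : ∀ ij ∈ F, (m₀ : ℝ) ≤ ((ij.1 : ℝ) + ij.2 / 2 + δ / 2) ^ 2 + 3 / 4 * ((ij.2 : ℝ) + δ / 3) ^ 2) :
    ∑ ij ∈ F, |lennardJones (Real.sqrt
        ((t₀₀ * ((ij.1 : ℝ) + (ij.2 : ℝ) / 2 + (δ : ℝ) / 2) + t₀₁ * (Real.sqrt 3 / 2 * ((ij.2 : ℝ) + (δ : ℝ) / 3)) +
            t₀₂ * ((s : ℝ) * (Real.sqrt 6 / 3))) ^ 2 +
          (t₁₁ * (Real.sqrt 3 / 2 * ((ij.2 : ℝ) + (δ : ℝ) / 3)) + t₁₂ * ((s : ℝ) * (Real.sqrt 6 / 3))) ^ 2 +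
          (t₂₂ * ((s : ℝ) * (Real.sqrt 6 / 3))) ^ 2))| ≤
      ((16 / 25 * (m₀ : ℝ) + 32 / 75 * (s : ℝ) ^ 2)⁻¹ ^ 3 / 12 + 1 / 6) *
        (10 * (((16 / 25 * (m₀ : ℝ) + 32 / 75 * (s : ℝ) ^ 2) ^ 3)⁻¹ +
            1 / (16 / 25 * (16 / 25 * (m₀ : ℝ) + 32 / 75 * (s : ℝ) ^ 2) ^ 2)) +
          10 * m₀ * ((16 / 25 * (m₀ : ℝ) + 32 / 75 * (s : ℝ) ^ 2) ^ 3)⁻¹) := by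
  refine tri_sum_abs_lj_sqrt_le_of_planar δ m₀ (by norm_num) hβ _ F (fun ij _ => ?_) hm
  have h := (htube ((ij.1 : ℝ) + (ij.2 : ℝ) / 2 + (δ : ℝ) / 2) (Real.sqrt 3 / 2 * ((ij.2 : ℝ) + (δ : ℝ) / 3))
    ((s : ℝ) * (Real.sqrt 6 / 3))).1
  rw [tri_coord_sq_eq] at h
  linarith

/-- **Reference layer sums, in-plane tails and whole layers (box ⇒ `(47/50)²Q_δ + s²(1833/2500)² ≤ ‖layerVec a h‖²`).**
For a box cell `47/50 ≤ a`, `39a/50 ≤ h` and a finite `F ⊆ ℤ²` of points of level `≥ m₀`,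
`∑_F |V_LJ ‖layerVec a h δ s i j‖| ≤` the planar majorant at `(a₁², c₂) = ((47/50)², s²(1833/2500)²)`. [folklore] -/
theorem tri_sum_abs_reference_le {a h : ℝ} (ha : 47 / 50 ≤ a) (hh : 39 / 50 * a ≤ h) (δ s : ℤ) (m₀ : ℕ)
    (hβ : 0 < (47 / 50 : ℝ) ^ 2 * (m₀ : ℝ) + (s : ℝ) ^ 2 * (1833 / 2500 : ℝ) ^ 2) (F : Finset (ℤ × ℤ))
    (hm : ∀ ij ∈ F, (m₀ : ℝ) ≤ ((ij.1 : ℝ) + ij.2 / 2 + δ / 2) ^ 2 + 3 / 4 * ((ij.2 : ℝ) + δ / 3) ^ 2) :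
    ∑ ij ∈ F, |lennardJones ‖layerVec a h δ s ij.1 ij.2‖| ≤
      (((47 / 50 : ℝ) ^ 2 * (m₀ : ℝ) + (s : ℝ) ^ 2 * (1833 / 2500 : ℝ) ^ 2)⁻¹ ^ 3 / 12 + 1 / 6) *
        (10 * ((((47 / 50 : ℝ) ^ 2 * (m₀ : ℝ) + (s : ℝ) ^ 2 * (1833 / 2500 : ℝ) ^ 2) ^ 3)⁻¹ +
            1 / ((47 / 50 : ℝ) ^ 2 * ((47 / 50 : ℝ) ^ 2 * (m₀ : ℝ) + (s : ℝ) ^ 2 * (1833 / 2500 : ℝ) ^ 2) ^ 2)) +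
          10 * m₀ * (((47 / 50 : ℝ) ^ 2 * (m₀ : ℝ) + (s : ℝ) ^ 2 * (1833 / 2500 : ℝ) ^ 2) ^ 3)⁻¹) := by
  have e : ∑ ij ∈ F, |lennardJones ‖layerVec a h δ s ij.1 ij.2‖| =
      ∑ ij ∈ F, |lennardJones (Real.sqrt (‖layerVec a h δ s ij.1 ij.2‖ ^ 2))| :=
    Finset.sum_congr rfl fun ij _ => by rw [Real.sqrt_sq (norm_nonneg _)]
  rw [e]
  refine tri_sum_abs_lj_sqrt_le_of_planar δ m₀ (by norm_num) hβ _ F (fun ij _ => ?_) hm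
  rw [normSq_layerVec]
  have ha0 : 0 ≤ a := by linarith
  have hh0 : (1833 / 2500 : ℝ) ≤ h := by nlinarith
  have h1 : (47 / 50 : ℝ) ^ 2 ≤ a ^ 2 := by nlinarith
  have h2 : (s : ℝ) ^ 2 * (1833 / 2500 : ℝ) ^ 2 ≤ ((s : ℝ) * h) ^ 2 := by
    rw [mul_pow]; exact mul_le_mul_of_nonneg_left (by nlinarith) (sq_nonneg _)
  have hQ : 0 ≤ ((ij.1 : ℝ) + ij.2 / 2 + δ / 2) ^ 2 + 3 / 4 * ((ij.2 : ℝ) + δ / 3) ^ 2 := by positivity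
  nlinarith [mul_le_mul_of_nonneg_right h1 hQ]

/-! ## Summability of the deformed and reference layer sums from the uniform partial-sum bounds -/

/-- A real family whose absolute partial sums over finite sets avoiding one point are uniformly bounded, and which vanishes
at that point, is summable. [folklore] -/
theorem tri_summable_of_sum_erase_le {g : ℤ × ℤ → ℝ} {c : ℝ} (p : ℤ × ℤ) (hp : g p = 0)
    (h : ∀ F : Finset (ℤ × ℤ), p ∉ F → ∑ ij ∈ F, |g ij| ≤ c) : Summable g := by
  classical
  refine Summable.of_abs (summable_of_sum_le (fun ij => abs_nonneg (g ij)) (c := c) fun F => ?_)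
  calc ∑ ij ∈ F, |g ij| ≤ ∑ ij ∈ insert p F, |g ij| :=
        Finset.sum_le_sum_of_subset_of_nonneg (Finset.subset_insert p F) fun _ _ _ => abs_nonneg _
    _ = |g p| + ∑ ij ∈ (insert p F).erase p, |g ij| := by
        rw [← Finset.add_sum_erase _ _ (Finset.mem_insert_self p F)]
    _ ≤ 0 + c := by
        rw [hp, abs_zero]
        exact add_le_add le_rfl (h _ (Finset.notMem_erase p _))
    _ = c := zero_add c

/-- The planar form `Q_0(i,j) = i² + ij + j²` is `≥ 1` off the origin. [folklore] -/
theorem tri_one_le_planarForm_zero {ij : ℤ × ℤ} (hij : ij ≠ (0, 0)) :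
    (1 : ℝ) ≤ ((ij.1 : ℝ) + ij.2 / 2 + (0 : ℤ) / 2) ^ 2 + 3 / 4 * ((ij.2 : ℝ) + (0 : ℤ) / 3) ^ 2 := by
  obtain ⟨i, j⟩ := ij
  have h : (1 : ℤ) ≤ i ^ 2 + i * j + j ^ 2 := by
    by_contra hlt
    push Not at hlt
    have hj : j ^ 2 ≤ 1 := by nlinarith [sq_nonneg (2 * i + j)]
    have hi : (2 * i + j) ^ 2 ≤ 3 := by nlinarith [sq_nonneg j]
    have hj1 : j ≤ 1 := by nlinarith
    have hj2 : -1 ≤ j := by nlinarith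
    have hi1 : 2 * i + j ≤ 1 := by nlinarith
    have hi2 : -1 ≤ 2 * i + j := by nlinarith
    have hi3 : i ≤ 1 := by omega
    have hi4 : -1 ≤ i := by omega
    interval_cases i <;> interval_cases j <;> simp_all
  have h' : (1 : ℝ) ≤ (i : ℝ) ^ 2 + i * j + j ^ 2 := by exact_mod_cast h
  push_cast
  nlinarith [h']

end Summit.AtomisticToContinuum.Crystallization.Theorems.NashClassCertificatesNashNearField

end
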